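import Summits.Ventures.Crystal3D.Theorems.StickyWulffConstantCoaxialWallLawSeamEndBallRigidity
import HarnessLib

/-!
# `SatCensus12` from KissingGap and the ONE-FREE-PAIR kissing classification (certificate-shaped input)
# (crux `CoaxialWallLaw`, stmt-Ventures-19481; lane F 'Certificates' v8.3, registered stub `stub_threePayer`, line of record
#  `threePayer_of_census stub_satCensus11 stub_satCensus12` of '…SeamEndBallRigidity')

HONEST FRAMING. Venture `Summits/Ventures/Crystal3D` (cell `crystal3d-full`); helper for the census fact `SatCensus12` ('…SeamEndBallRigidity':
a saturated ball of a `1`-separated configuration whose contact shell is NOT fcc/hcp-arranged has contact-neighbours of total deficiency `≥ 3`).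
`KissingGap (5/2)` + `KissingClassification (5/2)` (both tree theorems, computational grade) give deficiency `≥ 2`
(`two_unsaturated_of_not_closePacked`).  THIS FILE isolates the third unit as ONE certificate-shaped statement in Hales's own currency:

* `IsGapKissingConfigOneFree δ S` — twelve points of `S²(2)`, pairwise `≥ 2` apart, every pair at distance `2` or `≥ δ` EXCEPT POSSIBLY ONE PAIR;
* **`KissingClassificationOneFree δ`** — every such configuration is arranged in the fcc or the hcp pattern.  It implies `KissingClassification δ`
  for `δ ≥ 2` (`kissingClassification_of_oneFree`) and is the «one defective pair» extension of the tree's verified growth search BIMODAL(5/4)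
  (`kissingClassification_250`, `Kissing125/…`: there the dichotomy `dist = 2 ∨ dist ≥ 5/2` is assumed for ALL pairs);
* `isGapKissingConfigOneFree_kissingShell_allButTwo` — under GAP(δ), the shell of a twelve-kissed ball all of whose neighbours but TWO are
  twelve-kissed is such a configuration (the only pair not separated by GAP at one of its members is the exceptional pair);
* **`satCensus12_of_oneFree : KissingGap (5/2) → KissingClassificationOneFree (5/2) → SatCensus12`** — so a saturated non-arranged ball has at
  least THREE unsaturated contact-neighbours, each of deficiency `≥ 1`.
NUMERICAL STATUS (seat 19481-p2 g14, kit j335304 `P1b`): no non-arranged zero-energy one-free-pair configuration found by multi-start search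
(evidence on 19481); the certificate itself (a re-run of the κ = 7/32 growth search with one pair exempt from the dichotomy) is cf-p2/eng-shaped.
WHAT THIS IS NOT: `KissingClassificationOneFree (5/2)` is NOT proved here; `SatCensus11` is untouched; F-C1 not moved.
-/

noncomputable section

namespace Summit.Ventures.Crystal3D.Theorems

namespace TailResidue

open Summit.Ventures.Crystal3D Finset
open Literature.Geometry.DiscreteGeometry (fccKissingPattern hcpKissingPattern IsArrangedIn IsUnitBallPacking kissingShell)
open scoped InnerProductSpace

variable {X : Finset (EuclideanSpace ℝ (Fin 3))}

/-! ### The one-free-pair gap class and its classification (named, certificate-shaped) -/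

/-- **A `δ`-gap kissing configuration with ONE FREE PAIR**: twelve points of the sphere `S²(2)` (Hales's convention: unit RADIUS, contact at
distance `2`), pairwise at distance `≥ 2`, and every pair equal, touching (`dist = 2`) or `≥ δ` apart — except possibly the one pair `{a, b}`. -/
def IsGapKissingConfigOneFree (δ : ℝ) (S : Set (EuclideanSpace ℝ (Fin 3))) : Prop :=
  S.ncard = 12 ∧ (∀ x ∈ S, ‖x‖ = 2) ∧ (∀ x ∈ S, ∀ y ∈ S, x = y ∨ 2 ≤ dist x y) ∧
    ∃ a b : EuclideanSpace ℝ (Fin 3), ∀ x ∈ S, ∀ y ∈ S, x = y ∨ dist x y = 2 ∨ δ ≤ dist x y ∨ (x = a ∧ y = b) ∨ (x = b ∧ y = a)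

/-- **ONE-FREE-PAIR CLASSIFICATION(δ)** (named, certificate-shaped input; the «one defective pair» extension of BIMODAL = `KissingClassification δ`):
every `δ`-gap kissing configuration with one free pair is arranged in the fcc pattern (cuboctahedron) or the hcp pattern (anticuboctahedron). -/
def KissingClassificationOneFree (δ : ℝ) : Prop :=
  ∀ S : Set (EuclideanSpace ℝ (Fin 3)), IsGapKissingConfigOneFree δ S → IsArrangedIn S fccKissingPattern ∨ IsArrangedIn S hcpKissingPattern

/-- The one-free-pair classification implies the plain classification (for `δ ≥ 2`, so that the dichotomy contains the packing condition). -/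
theorem kissingClassification_of_oneFree {δ : ℝ} (hδ : 2 ≤ δ) (h : KissingClassificationOneFree δ) : KissingClassification δ := by
  intro S hS
  obtain ⟨hcard, hnorm, hdich⟩ := hS
  refine h S ⟨hcard, hnorm, fun x hx y hy => ?_, ⟨0, 0, fun x hx y hy => ?_⟩⟩
  · rcases hdich x hx y hy with e | e | e
    · exact Or.inl e
    · exact Or.inr (le_of_eq e.symm)
    · exact Or.inr (hδ.trans e)
  · rcases hdich x hx y hy with e | e | e
    · exact Or.inl e
    · exact Or.inr (Or.inl e)
    · exact Or.inr (Or.inr (Or.inl e))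

/-- `KissingClassificationOneFree` is monotone in `δ`. -/
theorem KissingClassificationOneFree.mono {δ δ' : ℝ} (hle : δ ≤ δ') (h : KissingClassificationOneFree δ) : KissingClassificationOneFree δ' := by
  intro S hS
  obtain ⟨hcard, hnorm, hsep, a, b, hdich⟩ := hS
  refine h S ⟨hcard, hnorm, hsep, a, b, fun x hx y hy => ?_⟩
  rcases hdich x hx y hy with e | e | e | e | e
  · exact Or.inl e
  · exact Or.inr (Or.inl e)
  · exact Or.inr (Or.inr (Or.inl (hle.trans e)))
  · exact Or.inr (Or.inr (Or.inr (Or.inl e)))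
  · exact Or.inr (Or.inr (Or.inr (Or.inr e)))

/-! ### Shells with all but two neighbours saturated are one-free-pair gap configurations -/

/-- **Shells are one-free-pair gap configurations, all-but-two form.**  If `u` is touched by twelve balls of the packing `V` and every ball touching
`u`, except possibly the ones centred at `w₀` and `w₁`, is itself touched by twelve, then the kissing shell of `u` is a `δ`-gap kissing
configuration with the free pair `{w₀ − u, w₁ − u}`: GAP(δ) at a twelve-kissed member separates it from every other member. -/
theorem isGapKissingConfigOneFree_kissingShell_allButTwo {δ : ℝ} (hg : KissingGap δ) {V : Set (EuclideanSpace ℝ (Fin 3))} {u : EuclideanSpace ℝ (Fin 3)} (hV : IsUnitBallPacking V)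
    (h12 : (kissingShell V u).ncard = 12) (w₀ w₁ : EuclideanSpace ℝ (Fin 3)) (hnb : ∀ w ∈ V, dist u w = 2 → w ≠ w₀ → w ≠ w₁ → (kissingShell V w).ncard = 12) :
    IsGapKissingConfigOneFree δ (kissingShell V u) := by
  refine ⟨h12, fun y hy => hy.2, fun y hy z hz => ?_, w₀ - u, w₁ - u, fun y hy z hz => ?_⟩
  · by_cases hyz : y = z
    · exact Or.inl hyz
    · right
      by_contra hlt
      push Not at hlt
      have h := hV hy.1 hz.1 (by rwa [dist_add_left])
      exact hyz (add_left_cancel h)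
  by_cases hyz : y = z
  · exact Or.inl hyz
  have hwy : dist u (u + y) = 2 := by rw [dist_eq_norm, sub_add_cancel_left, norm_neg, hy.2]
  have hwz : dist u (u + z) = 2 := by rw [dist_eq_norm, sub_add_cancel_left, norm_neg, hz.2]
  -- GAP at a saturated member separates it from all other members
  have sat_sep : ∀ {p q : EuclideanSpace ℝ (Fin 3)}, p ∈ kissingShell V u → q ∈ kissingShell V u → p ≠ q → (kissingShell V (u + p)).ncard = 12 →
      dist p q = 2 ∨ δ ≤ dist p q := by
    intro p q hp hq hpq hsat
    have h := hg V hV (u + p) hp.1 hsat (u + q) hq.1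
    rw [dist_add_left] at h
    rcases h with h | h | h
    · exact absurd (add_left_cancel h) hpq
    · exact Or.inl h
    · exact Or.inr h
  by_cases hy₀ : u + y = w₀
  · by_cases hz₁ : u + z = w₁
    · right; right; right; left
      exact ⟨by rw [← hy₀, add_sub_cancel_left], by rw [← hz₁, add_sub_cancel_left]⟩
    · have hz₀ : u + z ≠ w₀ := fun h => hyz (add_left_cancel (hy₀.trans h.symm))
      rcases sat_sep hz hy (Ne.symm hyz) (hnb (u + z) hz.1 hwz hz₀ hz₁) with h | h
      · exact Or.inr (Or.inl (by rw [dist_comm]; exact h))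
      · exact Or.inr (Or.inr (Or.inl (by rw [dist_comm]; exact h)))
  · by_cases hy₁ : u + y = w₁
    · by_cases hz₀ : u + z = w₀
      · right; right; right; right
        exact ⟨by rw [← hy₁, add_sub_cancel_left], by rw [← hz₀, add_sub_cancel_left]⟩
      · have hz₁ : u + z ≠ w₁ := fun h => hyz (add_left_cancel (hy₁.trans h.symm))
        rcases sat_sep hz hy (Ne.symm hyz) (hnb (u + z) hz.1 hwz hz₀ hz₁) with h | h
        · exact Or.inr (Or.inl (by rw [dist_comm]; exact h))
        · exact Or.inr (Or.inr (Or.inl (by rw [dist_comm]; exact h)))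
    · rcases sat_sep hy hz hyz (hnb (u + y) hy.1 hwy hy₀ hy₁) with h | h
      · exact Or.inr (Or.inl h)
      · exact Or.inr (Or.inr (Or.inl h))

/-- **Arranged shell, all-but-two form.**  Under GAP(`δ`) and the ONE-FREE-PAIR CLASSIFICATION(`δ`): in a finite `1`-separated configuration `X`,
a point `x` with twelve contacts, all of whose contact neighbours except possibly `y₀`, `y₁` have twelve contacts, has its contact shell arranged in the
fcc or the hcp pattern. -/
theorem closePacked_of_allButTwo {δ : ℝ} (hg : KissingGap δ) (hc : KissingClassificationOneFree δ)
    (hX : ∀ p ∈ X, ∀ q ∈ X, p ≠ q → 1 ≤ dist p q) {x : EuclideanSpace ℝ (Fin 3)}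
    (h12 : (X.filter fun q => dist x q = 1).card = 12) (y₀ y₁ : EuclideanSpace ℝ (Fin 3))
    (hnb : ∀ y ∈ X, dist x y = 1 → y ≠ y₀ → y ≠ y₁ → (X.filter fun q => dist y q = 1).card = 12) :
    IsArrangedIn ((fun q => (2 : ℝ) • (q - x)) '' {q | q ∈ X ∧ dist x q = 1}) fccKissingPattern ∨
      IsArrangedIn ((fun q => (2 : ℝ) • (q - x)) '' {q | q ∈ X ∧ dist x q = 1}) hcpKissingPattern := by
  have hV := isUnitBallPacking_two_smul_image hX
  rw [← kissingShell_two_smul_image]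
  refine hc _ (isGapKissingConfigOneFree_kissingShell_allButTwo hg hV ?_ ((2 : ℝ) • y₀) ((2 : ℝ) • y₁) fun w hw hd hw₀ hw₁ => ?_)
  · rw [kissingShell_two_smul_image, ncard_two_smul_sub_image, h12]
  · obtain ⟨y, hy, hxy, rfl⟩ := exists_eq_two_smul_of_dist_two hw hd
    have hyy₀ : y ≠ y₀ := fun h => hw₀ (by rw [h])
    have hyy₁ : y ≠ y₁ := fun h => hw₁ (by rw [h])
    rw [kissingShell_two_smul_image, ncard_two_smul_sub_image, hnb y hy hxy hyy₀ hyy₁]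

/-! ### `SatCensus12` -/

open scoped Classical in
/-- **Three unsaturated neighbours.**  Under GAP(`δ`) ∧ ONE-FREE-PAIR CLASSIFICATION(`δ`): a saturated ball whose shell is NOT arranged has at least
three distinct contact-neighbours with at most eleven contacts each. -/
theorem three_le_card_unsaturated_of_not_closePacked {δ : ℝ} (hg : KissingGap δ) (hc : KissingClassificationOneFree δ)
    (hX : ∀ p ∈ X, ∀ q ∈ X, p ≠ q → 1 ≤ dist p q) {b : EuclideanSpace ℝ (Fin 3)} (h12 : (X.filter fun q => dist b q = 1).card = 12)
    (hnot : ¬ (IsArrangedIn ((fun q => (2 : ℝ) • (q - b)) '' {q | q ∈ X ∧ dist b q = 1}) fccKissingPattern ∨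
      IsArrangedIn ((fun q => (2 : ℝ) • (q - b)) '' {q | q ∈ X ∧ dist b q = 1}) hcpKissingPattern)) :
    3 ≤ (X.filter fun y => dist b y = 1 ∧ (X.filter fun q => dist y q = 1).card ≤ 11).card := by
  set U := X.filter fun y => dist b y = 1 ∧ (X.filter fun q => dist y q = 1).card ≤ 11 with hU
  by_contra hlt
  push Not at hlt
  -- `U` has at most two elements: choose `y₀, y₁` covering it
  obtain ⟨y₀, y₁, hcov⟩ : ∃ y₀ y₁ : EuclideanSpace ℝ (Fin 3), ∀ y ∈ U, y = y₀ ∨ y = y₁ := by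
    rcases U.eq_empty_or_nonempty with hUe | ⟨y₀, hy₀⟩
    · exact ⟨b, b, fun y hy => by rw [hUe] at hy; exact absurd hy (Finset.notMem_empty y)⟩
    · by_cases h1 : U.card ≤ 1
      · exact ⟨y₀, y₀, fun y hy => Or.inl (Finset.card_le_one.1 h1 y hy y₀ hy₀)⟩
      · have h2 : U.card = 2 := by omega
        obtain ⟨a, c, -, hUe⟩ := Finset.card_eq_two.1 h2
        exact ⟨a, c, fun y hy => by simpa [hUe] using hy⟩
  refine hnot (closePacked_of_allButTwo hg hc hX h12 y₀ y₁ fun y hy hd h₀ h₁ => ?_)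
  have hle := card_filter_dist_eq_one_le_twelve X hX y
  by_contra hne
  have hyU : y ∈ U := mem_filter.2 ⟨hy, hd, by omega⟩
  rcases hcov y hyU with h | h
  · exact h₀ h
  · exact h₁ h

open scoped Classical in
/-- **`SatCensus12` from GAP(5/2) and the ONE-FREE-PAIR CLASSIFICATION(5/2).**  The three unsaturated contact-neighbours each contribute deficiency
`≥ 1` to the census sum. -/
theorem satCensus12_of_oneFree (hg : KissingGap (5 / 2)) (hc : KissingClassificationOneFree (5 / 2)) : SatCensus12 := by
  intro Y hY b _ h12 hnot
  set U := Y.filter fun y => dist b y = 1 ∧ (Y.filter fun q => dist y q = 1).card ≤ 11 with hU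
  have h3 := three_le_card_unsaturated_of_not_closePacked hg hc hY h12 hnot
  have hterm : ∀ y ∈ U, (1 : ℝ) ≤ (12 : ℝ) - ((Y.filter fun x => dist y x = 1).card : ℝ) := by
    intro y hy
    have : ((Y.filter fun x => dist y x = 1).card : ℝ) ≤ 11 := by exact_mod_cast (mem_filter.1 hy).2.2
    linarith
  calc (3 : ℝ) ≤ (U.card : ℝ) := by exact_mod_cast h3
    _ = ∑ _y ∈ U, (1 : ℝ) := by simp
    _ ≤ ∑ y ∈ U, ((12 : ℝ) - ((Y.filter fun x => dist y x = 1).card : ℝ)) := sum_le_sum hterm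

end TailResidue

end Summit.Ventures.Crystal3D.Theorems

end
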